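import Summits.CriticalPhenomena.PercolationContinuityZ3.Theorems.PercNearOneGluingNoHeavyPcintClusterExplorationRun
import Summits.CriticalPhenomena.PercolationContinuityZ3.Theorems.PercNearOneGluingNoHeavyPcintTFibGraph
import Literature.Probability.Percolation.SitePaths
import HarnessLib

/-!
# PCINT lane, T-fibre route, step (2F): the fibre process on a finite box and its open paths in `𝕋 × K_m`

Cell `prim-pcint`, seat `prim-pcint-1` (gen 11); memo `run/shared/lean/prim/pcint/T-FIBRE-ROUTE.md` §2.

The second process of `AdaptDom.expect_le_of_dominating` in the T-fibre route: on a finite set `Λ ⊆ ℤ²` of sites of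
the triangular lattice `𝕋` with root `o`, the sample space is the set of FIBRE STATES `w : Λ → (ZMod m → Bool)` (the
states of the `m` sites `(v, i)` of `𝕋 × K_m` above each `v ∈ Λ`), and the oracle `outF` reports, when the cluster
exploration rule `ClusterExpl.rule` (root first, then the unrevealed `Λ`-neighbours of the selected revealed-true site
`b`) examines a site `a`:

* at the root step, `[w o = allOpen]` (every site of the fibre of `o` is open — the root rule);
* afterwards, `[meet (w b) (w a)]` (some layer `i` has both `(b, i)` and `(a, i)` open).

Since the fibres are cliques, every open site of the fibre of a reached vertex is joined to the cluster:
`pathIn_of_run_eq_some_true` — every site revealed TRUE by the run carries, for each of its open fibre sites `(v, j)`,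
an OPEN PATH of `𝕋 × K_m` inside `cfgF w` from `(o, 0)` to `(v, j)`; and `exists_pathIn_of_reach` — if the payoff
`ClusterExpl.reachIndicator` of the final state is `1` for a target set `B`, such a path reaches the fibre of a site of `B`.
This is the analogue of `…PcintVdBEProcess.lean` (van den Berg–Ermakov's pair process) for the fibre lattice.
-/

noncomputable section

namespace Summit.CriticalPhenomena.PercolationContinuityZ3.Theorems.Pcint

namespace TFib

open Finset AdaptDom ClusterExpl Literature.Probability.Percolation Literature.Probability.LatticeModels

variable (m : ℕ) (Λ : Finset (Site 2))

/-- The triangular lattice induced on the finite set `Λ`. -/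
def boxGraphT : SimpleGraph ↥Λ := SimpleGraph.comap (fun v : ↥Λ => v.1) triGraph

/-- Adjacency in the box graph is `𝕋`-adjacency of the underlying sites. -/
theorem boxGraphT_adj {a b : ↥Λ} : (boxGraphT Λ).Adj a b ↔ triGraph.Adj a.1 b.1 := Iff.rfl

/-- Adjacency in the box graph is decidable. -/
instance instDecidableRelBoxGraphTAdj : DecidableRel (boxGraphT Λ).Adj := fun a b =>
  inferInstanceAs (Decidable (triGraph.Adj a.1 b.1))

/-- The all-open fibre state (root rule). -/
def allOpen : ZMod m → Bool := fun _ => true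

/-- Two fibre states `meet` if some layer is open in both. -/
def meet [NeZero m] (x y : ZMod m → Bool) : Bool := decide (∃ i, x i = true ∧ y i = true)

variable {m} in
/-- `meet x y = true` iff some layer is open in both. -/
theorem meet_eq_true_iff [NeZero m] {x y : ZMod m → Bool} : meet m x y = true ↔ ∃ i, x i = true ∧ y i = true := by
  simp [meet]

variable {m} in
/-- `meet` is symmetric. -/
theorem meet_comm [NeZero m] (x y : ZMod m → Bool) : meet m x y = meet m y x := by
  have : (∃ i, x i = true ∧ y i = true) ↔ ∃ i, y i = true ∧ x i = true := exists_congr fun i => and_comm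
  by_cases h : ∃ i, x i = true ∧ y i = true
  · rw [(meet_eq_true_iff).2 h, ((meet_eq_true_iff).2 (this.1 h))]
  · have h' : ¬ ∃ i, y i = true ∧ x i = true := fun h'' => h (this.2 h'')
    rw [Bool.eq_false_iff.2 (fun hh => h (meet_eq_true_iff.1 hh)), Bool.eq_false_iff.2 (fun hh => h' (meet_eq_true_iff.1 hh))]

/-- The `𝕋 × K_m` site configuration of a fibre-state assignment: the open fibre sites above `Λ`. -/
def cfgF (w : ↥Λ → (ZMod m → Bool)) : Set (Site 2 × ZMod m) := {s | ∃ v : ↥Λ, s.1 = v.1 ∧ w v s.2 = true}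

variable {m Λ}

/-- A fibre site above `v ∈ Λ` is open iff the corresponding bit is set. -/
theorem mk_mem_cfgF_iff {w : ↥Λ → (ZMod m → Bool)} {v : ↥Λ} {i : ZMod m} : (v.1, i) ∈ cfgF m Λ w ↔ w v i = true := by
  constructor
  · rintro ⟨u, hu, h⟩
    have : u = v := Subtype.ext hu.symm
    subst this; exact h
  · intro h; exact ⟨v, rfl, h⟩

variable (m Λ) (enc : ↥Λ → ℕ) (o : ↥Λ)

/-- **The fibre oracle**: at the root step report `[w o = allOpen]`; afterwards report whether the fibre of the examined
site meets the fibre of the selected site. -/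
def outF [NeZero m] (w : ↥Λ → (ZMod m → Bool)) (σ : ↥Λ → Option Bool) (a : ↥Λ) : Bool :=
  if ∀ v, σ v = none then decide (w a = allOpen m)
  else match sel (boxGraphT Λ) enc σ with
    | none => false
    | some b => meet m (w b) (w a)

variable {m Λ enc o}
variable [NeZero m]

/-- At the initial state the oracle reports `[w a = allOpen]`. -/
theorem outF_init (w : ↥Λ → (ZMod m → Bool)) {τ : ↥Λ → Option Bool} (h : ∀ v, τ v = none) (a : ↥Λ) :
    outF m Λ enc w τ a = decide (w a = allOpen m) := by
  unfold outF; rw [if_pos h]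

/-- At a non-initial state with no selected site the oracle reports `false`. -/
theorem outF_none (w : ↥Λ → (ZMod m → Bool)) {τ : ↥Λ → Option Bool} (h : ¬ ∀ v, τ v = none)
    (hsel : sel (boxGraphT Λ) enc τ = none) (a : ↥Λ) : outF m Λ enc w τ a = false := by
  unfold outF; rw [if_neg h, hsel]

/-- At a non-initial state with selected site `b` the oracle reports `meet (w b) (w a)`. -/
theorem outF_sel (w : ↥Λ → (ZMod m → Bool)) {τ : ↥Λ → Option Bool} (h : ¬ ∀ v, τ v = none) {b : ↥Λ}
    (hsel : sel (boxGraphT Λ) enc τ = some b) (a : ↥Λ) : outF m Λ enc w τ a = meet m (w b) (w a) := by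
  unfold outF; rw [if_neg h, hsel]

omit [NeZero m] in
/-- Two open sites of one fibre are joined by a path inside the configuration (the fibre is a clique). -/
theorem pathIn_fibre {w : ↥Λ → (ZMod m → Bool)} {v : ↥Λ} {i j : ZMod m} (hi : w v i = true) (hj : w v j = true) :
    PathIn (tfib m) (cfgF m Λ w) (v.1, i) (v.1, j) := by
  by_cases hij : i = j
  · subst hij; exact PathIn.refl (mk_mem_cfgF_iff.2 hi)
  · exact PathIn.of_adj (mk_mem_cfgF_iff.2 hi) (mk_mem_cfgF_iff.2 hj) ((tfib_adj _ _).2 (Or.inr ⟨rfl, hij⟩))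

/-- **Every site revealed true carries open paths from `(o, 0)` to all its open fibre sites**: along the fibre run, if
`v` is revealed true after `n` steps then the fibre of `o` is all-open and, for every open layer `j` of `v`, there is an
open `𝕋 × K_m`-path in `cfgF w` from `(o, 0)` to `(v, j)` (each revealed-true site meets the fibre of its examiner). -/
theorem pathIn_of_run_eq_some_true (w : ↥Λ → (ZMod m → Bool)) :
    ∀ (n : ℕ) (v : ↥Λ), run (rule (boxGraphT Λ) enc o) (outF m Λ enc w) n v = some true →
      w o = allOpen m ∧ ∀ j, w v j = true → PathIn (tfib m) (cfgF m Λ w) (o.1, 0) (v.1, j)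
  | 0, v, hv => by simp [run] at hv
  | n + 1, v, hv => by
    set τ := run (rule (boxGraphT Λ) enc o) (outF m Λ enc w) n with hτ
    change stepPA (rule (boxGraphT Λ) enc o τ) τ (outF m Λ enc w τ) v = some true at hv
    unfold stepPA at hv
    by_cases hvR : v ∈ rule (boxGraphT Λ) enc o τ
    · rw [if_pos hvR, Option.some.injEq] at hv
      by_cases hinit : ∀ u, τ u = none
      · -- root step: `v = o`, all layers open
        rw [outF_init w hinit, decide_eq_true_eq] at hv
        have hR : rule (boxGraphT Λ) enc o τ = {o} := by rw [rule, if_pos hinit]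
        rw [hR, mem_singleton] at hvR
        subst hvR
        refine ⟨hv, fun j hj => pathIn_fibre (by rw [hv]; rfl) hj⟩
      · cases hsel : sel (boxGraphT Λ) enc τ with
        | none => rw [outF_none w hinit hsel] at hv; exact absurd hv (by simp)
        | some b =>
          rw [outF_sel w hinit hsel] at hv
          obtain ⟨i, hbi, hvi⟩ := meet_eq_true_iff.1 hv
          have hb : τ b = some true := (sel_revealedTrue (boxGraphT Λ) enc hsel).1
          obtain ⟨ho, hpath⟩ := pathIn_of_run_eq_some_true w n b hb
          have hbv : triGraph.Adj b.1 v.1 := by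
            have := rule_eq_filter_of_sel (boxGraphT Λ) enc o hinit hsel
            rw [this, mem_filter] at hvR
            exact (boxGraphT_adj Λ).1 hvR.2.1
          refine ⟨ho, fun j hj => ?_⟩
          -- `(o,0) ⟶ (b,i) ⟶ (v,i) ⟶ (v,j)`
          have h1 : PathIn (tfib m) (cfgF m Λ w) (o.1, 0) (b.1, i) := hpath i hbi
          have h2 : PathIn (tfib m) (cfgF m Λ w) (b.1, i) (v.1, i) :=
            PathIn.of_adj (mk_mem_cfgF_iff.2 hbi) (mk_mem_cfgF_iff.2 hvi) ((tfib_adj _ _).2 (Or.inl ⟨hbv, rfl⟩))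
          exact (h1.trans h2).trans (pathIn_fibre hvi hj)
    · rw [if_neg hvR] at hv
      exact pathIn_of_run_eq_some_true w n v hv

/-- A site revealed true by the fibre run has an open fibre site (it met its examiner, or it is the all-open root). -/
theorem exists_open_of_run_eq_some_true (w : ↥Λ → (ZMod m → Bool)) :
    ∀ (n : ℕ) (v : ↥Λ), run (rule (boxGraphT Λ) enc o) (outF m Λ enc w) n v = some true → ∃ j, w v j = true
  | 0, v, hv => by simp [run] at hv
  | n + 1, v, hv => by
    set τ := run (rule (boxGraphT Λ) enc o) (outF m Λ enc w) n with hτ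
    change stepPA (rule (boxGraphT Λ) enc o τ) τ (outF m Λ enc w τ) v = some true at hv
    unfold stepPA at hv
    by_cases hvR : v ∈ rule (boxGraphT Λ) enc o τ
    · rw [if_pos hvR, Option.some.injEq] at hv
      by_cases hinit : ∀ u, τ u = none
      · rw [outF_init w hinit, decide_eq_true_eq] at hv
        exact ⟨0, by rw [hv]; rfl⟩
      · cases hsel : sel (boxGraphT Λ) enc τ with
        | none => rw [outF_none w hinit hsel] at hv; exact absurd hv (by simp)
        | some b =>
          rw [outF_sel w hinit hsel] at hv
          obtain ⟨i, -, hvi⟩ := meet_eq_true_iff.1 hv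
          exact ⟨i, hvi⟩
    · rw [if_neg hvR] at hv
      exact exists_open_of_run_eq_some_true w n v hv

/-- **If the payoff of the final state is `1`, an open `𝕋 × K_m`-path joins `(o, 0)` to the fibre of a target site**:
`reachIndicator = 1` for the target set `B` on (any completion of) the state after `|Λ| + 1` steps gives some `v ∈ B`
revealed true (`ClusterExpl.mem_revealedTrue_of_openPath`), hence the path. -/
theorem exists_pathIn_of_reach (w : ↥Λ → (ZMod m → Bool)) (B : Finset ↥Λ) (ω₀ : ↥Λ → Bool)
    (h : reachIndicator (boxGraphT Λ) o B
      (merge (run (rule (boxGraphT Λ) enc o) (outF m Λ enc w) (Fintype.card ↥Λ + 1)) ω₀) = 1) :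
    ∃ v ∈ B, ∃ j : ZMod m, PathIn (tfib m) (cfgF m Λ w) (o.1, 0) (v.1, j) := by
  set σ := run (rule (boxGraphT Λ) enc o) (outF m Λ enc w) (Fintype.card ↥Λ + 1) with hσ
  have hex : ∃ v ∈ B, OpenPath (boxGraphT Λ) o (merge σ ω₀) v := by
    by_contra hne
    unfold reachIndicator at h
    rw [if_neg hne] at h
    exact zero_ne_one h
  obtain ⟨v, hvB, hp⟩ := hex
  have hterm : rule (boxGraphT Λ) enc o σ = ∅ := rule_run_card_succ (boxGraphT Λ) enc o _
  have ho : σ o ≠ none := run_root_ne_none (boxGraphT Λ) enc o _ _ (Nat.le_add_left 1 _)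
  have hne : ¬ ∀ u, σ u = none := fun hall => ho (hall o)
  have hv : σ v = some true := mem_revealedTrue_of_openPath (boxGraphT Λ) enc o hne hterm ho hp
  obtain ⟨j, hj⟩ := exists_open_of_run_eq_some_true (enc := enc) (o := o) w _ v hv
  exact ⟨v, hvB, j, (pathIn_of_run_eq_some_true (enc := enc) (o := o) w _ v hv).2 j hj⟩

end TFib

end Summit.CriticalPhenomena.PercolationContinuityZ3.Theorems.Pcint

end
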